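/-
Copyright (c) 2026 the pub-hodgecm-mathlib formalisation cell (harness21).  Prover seat hodgecm-mathlib-K2E1-p11 (g3), Track B ∕ K2-LIT, h413 = `stmt-HodgeConjecture-24833`,
R90-TF section S8 «ContSpec-n½», #2 road (G side), S8 dealer R90-CS-plan (g2) S8-R51 (c) (census `R90/S8/CENSUS-GDEFS.K2E1-p11-g3.md` items (1)+(2)): the N = 3 TWIN of ★ p862464
`R90S8ResHBlockDataU2Defs` (K2E1-p15) ON MOK'S CARRIER `quasiSplit L⁺ L c 3` (G-SIDE SEAM RULE S8-R51) — the `(K′, ω)`-block `Sc` of a Borel datum `(χ₁, χ₂)`, its atoms (top ∕ middle slots of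
a block-model coordinate map) and its line part (regime R1).
-/
import Summits.HodgeConjecture.HodgeConjecture.Theorems.K2E1ChiSectionSpaceU3PairDefs   -- ★ p862227 (D-S8-3′): `chiSectionSpacePair χ₁ χ₂ K′ ω` — the N = 3 pair section space `V(χ₁, χ₂; K′, ω)`
import Summits.HodgeConjecture.HodgeConjecture.Theorems.K2E1BorelEisensteinUDefs       -- ★ `eisensteinSeriesU` (generic datum), `flatSectionU`; brings ★ `borelHeight`, ★ `AdelicGroupData.quotFun`
import Mathlib.Analysis.InnerProductSpace.Projection.Submodule                            -- Mathlib `Submodule.orthogonal` (`ᗮ`), `Submodule.inner_right_of_mem_orthogonal`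
import HarnessLib

/-!
# S8 #2 road (G side) — `R90S8ResGBlockDataU3Defs`: THE BLOCK DATA OF RECORD `Sc ∕ At ∕ Ln` ON `U_{L/L⁺}(3) = quasiSplit L⁺ L c 3` for the LAYER 2 G-PRINT ★ F1_qs
# `residualG_le_topologicalClosure_of_letters_quasiSplit` (regime R1; N = 3 twin of ★ p862464 `R90S8ResHBlockDataU2Defs`)

Track B ∕ K2-LIT, crux h413 = `stmt-HodgeConjecture-24833`, route of record `HCCMUnconditional`; cell `hodgecm-mathlib`, R90-TF programme, section S8 «ContSpec-n½», socket #2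
`sock_S8_res_classification` (B ED. 4 :205–:214) and its ED. 5 sub-sockets EXH ∕ MID (S8-R51 (c)).  DEFINITIONS FILE (`--kind definition --supports stmt-HodgeConjecture-24833 --as helper`):
five `def`s + `Iff.rfl`∕`inf_le`-deep read-backs; no `instance`, no `notation`, no named-fact hypothesis, no `sorry`; PRINT currency `quasiSplit L⁺ L c 3` (G-SIDE SEAM RULE S8-R51: all
G-letter payers type on Mok's carrier, the literal `Φ₃` lives only in ★ F3 `R90S8ResGTransportOfQuasiSplitU3` + B's socket lines); GENERIC in the level datum `(K' : Subgroup G(𝔸)) (ω : ↥K' →* ℂ)`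
and pointwise in the Borel datum `(χ₁, χ₂)` (LETTER SHAPE RULE S8-R29 (2)).  CLOSES NO SOCKET; pays no letter; it FIXES THE BYTES the G-letter payers key to ((HEAD₃) right side ∕ (E_blk,₃)
left side = D1; (O₃)(N_blk,₃)(L₃) over D2∕D3), exactly as ★ p862464 does on the H side.

THE MATHEMATICS ([MoeglinWaldspurger1995, I.2.17–18, II.2.1, II.2.4, V.3.13, VI.2]; [Langlands1976, §7]; rank one `U(2,1)` [Rogawski1990, §13.9 p. 229]).  The Borel `B = T·N` of
`G = U_{L/L⁺}(3)` has Levi `T ≅ L^× × U(1)_{L/L⁺}`; a cuspidal datum of `B` is a PAIR `(χ₁, χ₂)` (`χ₁` a Hecke character of `L`, `χ₂` a character of the norm-one torus — ★ `IsChiSectionPair`,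
`φ(b g) = χ₁(b₀₀) χ₂(b₁₁) φ(g)`), and for a level datum `(K′, ω)` the `L²` pseudo-Eisenstein series (wave packets) `[θ_{f,φ}] = [E(f(H)·φ)]`, `f ∈ C_c((0,∞))` continuous, `φ ∈ V(χ₁, χ₂; K′, ω)`
continuous (★ `chiSectionSpacePair`), span the `(K′,ω)`-BLOCK `Sc(K′, ω; χ₁, χ₂)` := their CLOSED span in `L²(G(L⁺)∖G(𝔸_{L⁺}), μ)` (D1 `resGBlock`).  Its spectral decomposition [MW VI.2;
§13.9 p. 229] is `Sc = (⊕ Res_{z=2}) ⊕ (⊕ Res_{z=3/2}) ⊕ 𝓛`: TOP-pole residue atoms (`χ₁|` trivial — the character lines `ℂ·[ψ∘det]`, case (i), ★ F6), MIDDLE-pole residue atoms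
(`χ₁′ = ω_{L/L⁺}`, `L(½, χ₁) ≠ 0` — the `πⁿ(ξ)`-blocks, case (ii)) and the unitary-axis continuous part (E1 normalisation `s = z − 1`: Godement domain `2 < Re z`, poles `z = 2`, `z = 3/2`,
★ F5 `K2E1ChiScatteringPoleDichotomyU3`).  REGIME R1 (S8-R35 (1), as ★ p862464): the E1 estate reads the block through a BLOCK-MODEL COORDINATE MAP, here with THREE slots
`U : L² →ₗ[ℂ] (A × M) × Λ` (top atoms × middle atoms × line); the atoms are D2 `resGAtom U := Sc ⊓ ker (snd ∘ U)` with its two sub-slots `resGAtomTop U` (middle coordinate `0`) and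
`resGAtomMid U` (top coordinate `0`), and the LINE part is DEFINED as the orthocomplement of the atoms inside the block, D3 `resGLine U := Sc ⊓ (resGAtom U)ᗮ` — so (E_blk,₃)
`Sc ≤ closure (At ⊔ Ln)` is Hilbert-space algebra, (O₃) holds in-block by definition, (N_blk,₃)'s interface is `inner_eq_zero_of_mem_resGLine`, and the deep letters are (L₃-i) «top
atoms are character classes» (★ F6 `span_le_iSup_lineSubrep_cmDetChar_three_of_forall_ae_eq`) and (L₃-ii) «middle atoms lie in the `πⁿ`-blocks» (the ξ-indexed middle block of
record `resGMidAtom ξ` and its MID socket are a SEPARATE defs file, census item (3β), pending the dealer's ruling on the continuation predicate).  `U` is a PARAMETER (the payers' model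
letters say which `U`); these defs assert nothing about `U` and are closed terms today.
* D1 `resGBlock K' ω χ₁ χ₂` (+ `resGBlock_def`, `subset_resGBlock`, `span_le_resGBlock`, `isClosed_resGBlock`).
* D2 `resGAtom U K' ω χ₁ χ₂`, `resGAtomTop U …`, `resGAtomMid U …` (+ `mem_…_iff`, `…_le_resGBlock`, `…_le_resGAtom`, `resGAtom_le_ker`, `resGAtomTop_sup_resGAtomMid_le_resGAtom`).
* D3 `resGLine U K' ω χ₁ χ₂` (+ `mem_resGLine_iff`, `resGLine_le_resGBlock`, `resGLine_le_orthogonal_resGAtom`, `isOrtho_resGAtom_resGLine`, `isOrtho_resGAtomTop_resGLine`,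
  `isOrtho_resGAtomMid_resGLine`, **`inner_eq_zero_of_mem_resGLine`** = the (N-iface), instance-free).
CONSUMER SHAPE (★ F1_qs): `Blk := fun ℓ b => resGBlock L μ (K' ℓ) (ω ℓ) (χ₁ b) (χ₂ b)`, `At := fun ℓ b => resGAtom L μ (U ℓ b) …` (or the top∕middle slots separately with
`Bn`), `Ln := fun ℓ b => resGLine L μ (U ℓ b) …`.
HONEST LABEL: HC_CM is proved only modulo the 7 printed citations (2 remaining named inputs: hLiu418 = `stmt-HodgeConjecture-24832`, h413 = `stmt-HodgeConjecture-24833`) until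
rung 0 closes; REL ≠ ★ ≠ BUILT; definitions pay nothing; count-neutral.

## References
* [MoeglinWaldspurger1995] C. Mœglin, J.-L. Waldspurger, *Spectral Decomposition and Eisenstein Series* (1995), I.2.17–18, II.2.1, II.2.4, V.3.13, VI.2.
* [Langlands1976] R. P. Langlands, *On the Functional Equations Satisfied by Eisenstein Series*, LNM 544 (1976), §7.
* [Rogawski1990] J. D. Rogawski, *Automorphic Representations of Unitary Groups in Three Variables* (1990), §13.9 p. 229.
-/

set_option autoImplicit false
set_option linter.dupNamespace false  -- the mandated namespace `…HodgeConjecture.HodgeConjecture.R90.S8` (LEAD #1 L1) repeats the summit's segment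

noncomputable section

open MeasureTheory Measure Set Filter Topology NumberField
open Literature.NumberTheory.Automorphic Literature.NumberTheory.Automorphic.UnitaryGroup Literature.NumberTheory.GaloisRepresentations AdelicGroupData
open Literature.NumberTheory.Automorphic.Arthur2013.Leaves.TECR
open Summit.HodgeConjecture.HodgeConjecture.Cruxes.H413.K2E1BorelEisensteinU
open Summit.HodgeConjecture.HodgeConjecture.Cruxes.H413.K2E1ChiSectionSpaceU3PairDefs
open scoped ENNReal NNReal InnerProductSpace

namespace Summit.HodgeConjecture.HodgeConjecture.R90.S8

variable (L : Type) [Field L] [NumberField L] [IsCMField L]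
  (μ : Measure (quasiSplit (↥(maximalRealSubfield L)) L (IsCMField.complexConj L) 3).automorphicQuotient)

/-! ## D1 The `(K′, ω)`-block `Sc(K′, ω; χ₁, χ₂)` — closed span of the `L²` pseudo-Eisenstein wave packets of the pair datum -/

/-- **D1 — THE `(K′, ω)`-BLOCK `Sc(K′, ω; χ₁, χ₂)` OF THE BOREL DATUM `(χ₁, χ₂)` OF `U_{L/L⁺}(3)`**: the closed span in `L²(G(L⁺)∖G(𝔸_{L⁺}), μ)` of the classes of the pseudo-Eisenstein series
`E(f(H)·φ)` with `f ∈ C_c((0,∞))` continuous and `φ ∈ V(χ₁, χ₂; K′, ω)` continuous (★ `chiSectionSpacePair`) — the N = 3 twin of ★ `resHBlock` (`chiSectionSpace χ ↦ chiSectionSpacePair χ₁ χ₂`);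
the right side of (HEAD₃) and the left side of (E_blk,₃). [cite: MoeglinWaldspurger1995, II.2.1, II.2.4] [cite: Rogawski1990, §13.9 p. 229] -/
def resGBlock (K' : Subgroup (quasiSplit (↥(maximalRealSubfield L)) L (IsCMField.complexConj L) 3).Adelic) (ω : ↥K' →* ℂ)
    (χ₁ : HeckeCharacter L) (χ₂ : ↥(TorusDict.torus (IsCMField.complexConj L)) →ₜ* ℂˣ) :
    Submodule ℂ ((quasiSplit (↥(maximalRealSubfield L)) L (IsCMField.complexConj L) 3).L2 μ) :=
  (Submodule.span ℂ {v : (quasiSplit (↥(maximalRealSubfield L)) L (IsCMField.complexConj L) 3).L2 μ |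
      ∃ (f : ℝ → ℂ) (_ : Continuous f) (_ : HasCompactSupport f) (_ : tsupport f ⊆ Ioi 0)
        (φ : (quasiSplit (↥(maximalRealSubfield L)) L (IsCMField.complexConj L) 3).Adelic → ℂ) (_ : φ ∈ chiSectionSpacePair χ₁ χ₂ K' (ω : ↥K' → ℂ)) (_ : Continuous φ)
        (hv : MemLp ((quasiSplit (↥(maximalRealSubfield L)) L (IsCMField.complexConj L) 3).quotFun (eisensteinSeriesU (fun g => f (borelHeight g) * φ g))) 2 μ), v = hv.toLp _}).topologicalClosure

/-- Read-back: `resGBlock` unfolds to the print's bytes (`rfl`). [cite: MoeglinWaldspurger1995, II.2.4] -/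
theorem resGBlock_def (K' : Subgroup (quasiSplit (↥(maximalRealSubfield L)) L (IsCMField.complexConj L) 3).Adelic) (ω : ↥K' →* ℂ)
    (χ₁ : HeckeCharacter L) (χ₂ : ↥(TorusDict.torus (IsCMField.complexConj L)) →ₜ* ℂˣ) :
    resGBlock L μ K' ω χ₁ χ₂ =
      (Submodule.span ℂ {v : (quasiSplit (↥(maximalRealSubfield L)) L (IsCMField.complexConj L) 3).L2 μ |
          ∃ (f : ℝ → ℂ) (_ : Continuous f) (_ : HasCompactSupport f) (_ : tsupport f ⊆ Ioi 0)
            (φ : (quasiSplit (↥(maximalRealSubfield L)) L (IsCMField.complexConj L) 3).Adelic → ℂ) (_ : φ ∈ chiSectionSpacePair χ₁ χ₂ K' (ω : ↥K' → ℂ)) (_ : Continuous φ)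
            (hv : MemLp ((quasiSplit (↥(maximalRealSubfield L)) L (IsCMField.complexConj L) 3).quotFun (eisensteinSeriesU (fun g => f (borelHeight g) * φ g))) 2 μ), v = hv.toLp _}).topologicalClosure :=
  rfl

/-- Read-back: the generating wave packets lie in the block. [cite: MoeglinWaldspurger1995, II.2.1] -/
theorem subset_resGBlock (K' : Subgroup (quasiSplit (↥(maximalRealSubfield L)) L (IsCMField.complexConj L) 3).Adelic) (ω : ↥K' →* ℂ)
    (χ₁ : HeckeCharacter L) (χ₂ : ↥(TorusDict.torus (IsCMField.complexConj L)) →ₜ* ℂˣ) :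
    {v : (quasiSplit (↥(maximalRealSubfield L)) L (IsCMField.complexConj L) 3).L2 μ |
        ∃ (f : ℝ → ℂ) (_ : Continuous f) (_ : HasCompactSupport f) (_ : tsupport f ⊆ Ioi 0)
          (φ : (quasiSplit (↥(maximalRealSubfield L)) L (IsCMField.complexConj L) 3).Adelic → ℂ) (_ : φ ∈ chiSectionSpacePair χ₁ χ₂ K' (ω : ↥K' → ℂ)) (_ : Continuous φ)
          (hv : MemLp ((quasiSplit (↥(maximalRealSubfield L)) L (IsCMField.complexConj L) 3).quotFun (eisensteinSeriesU (fun g => f (borelHeight g) * φ g))) 2 μ), v = hv.toLp _} ⊆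
      (resGBlock L μ K' ω χ₁ χ₂ : Set ((quasiSplit (↥(maximalRealSubfield L)) L (IsCMField.complexConj L) 3).L2 μ)) :=
  Submodule.subset_span.trans (Submodule.le_topologicalClosure _)

/-- Read-back: the algebraic span of the wave packets lies in the block (the shape (E_blk,₃)'s payer starts from). [cite: MoeglinWaldspurger1995, II.2.1] -/
theorem span_le_resGBlock (K' : Subgroup (quasiSplit (↥(maximalRealSubfield L)) L (IsCMField.complexConj L) 3).Adelic) (ω : ↥K' →* ℂ)
    (χ₁ : HeckeCharacter L) (χ₂ : ↥(TorusDict.torus (IsCMField.complexConj L)) →ₜ* ℂˣ) :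
    Submodule.span ℂ {v : (quasiSplit (↥(maximalRealSubfield L)) L (IsCMField.complexConj L) 3).L2 μ |
        ∃ (f : ℝ → ℂ) (_ : Continuous f) (_ : HasCompactSupport f) (_ : tsupport f ⊆ Ioi 0)
          (φ : (quasiSplit (↥(maximalRealSubfield L)) L (IsCMField.complexConj L) 3).Adelic → ℂ) (_ : φ ∈ chiSectionSpacePair χ₁ χ₂ K' (ω : ↥K' → ℂ)) (_ : Continuous φ)
          (hv : MemLp ((quasiSplit (↥(maximalRealSubfield L)) L (IsCMField.complexConj L) 3).quotFun (eisensteinSeriesU (fun g => f (borelHeight g) * φ g))) 2 μ), v = hv.toLp _} ≤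
      resGBlock L μ K' ω χ₁ χ₂ :=
  Submodule.le_topologicalClosure _

/-- Read-back: the block is closed (hence complete — the orthogonal projection onto it exists). [cite: MoeglinWaldspurger1995, II.2.4] -/
theorem isClosed_resGBlock (K' : Subgroup (quasiSplit (↥(maximalRealSubfield L)) L (IsCMField.complexConj L) 3).Adelic) (ω : ↥K' →* ℂ)
    (χ₁ : HeckeCharacter L) (χ₂ : ↥(TorusDict.torus (IsCMField.complexConj L)) →ₜ* ℂˣ) :
    IsClosed (resGBlock L μ K' ω χ₁ χ₂ : Set ((quasiSplit (↥(maximalRealSubfield L)) L (IsCMField.complexConj L) 3).L2 μ)) :=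
  Submodule.isClosed_topologicalClosure _

/-! ## D2 The atoms `At = Sc ⊓ ker (snd ∘ U)` with their TOP ∕ MIDDLE slots, and D3 the line part `Ln = Sc ⊓ Atᗮ` (regime R1, three-slot model map) -/

variable {A M Λ : Type*} [AddCommGroup A] [Module ℂ A] [AddCommGroup M] [Module ℂ M] [AddCommGroup Λ] [Module ℂ Λ]

/-- **D2 — THE ATOM PART `At(U; K′, ω; χ₁, χ₂) := Sc ⊓ ker (snd ∘ U)`**: the block vectors whose LINE coordinate vanishes in a three-slot block-model coordinate map
`U : L² →ₗ[ℂ] (A × M) × Λ` (top atoms × middle atoms × line).  In the mathematics: the span of the residues `Res_{z=2} E(φ, z)` (case (i), character lines) and `Res_{z=3/2} E(φ, z)`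
(case (ii), the `πⁿ(ξ)`-blocks), `φ ∈ V(χ₁, χ₂; K′, ω)`. [cite: MoeglinWaldspurger1995, V.3.13, VI.2] [cite: Rogawski1990, §13.9 p. 229] -/
def resGAtom (U : (quasiSplit (↥(maximalRealSubfield L)) L (IsCMField.complexConj L) 3).L2 μ →ₗ[ℂ] (A × M) × Λ)
    (K' : Subgroup (quasiSplit (↥(maximalRealSubfield L)) L (IsCMField.complexConj L) 3).Adelic) (ω : ↥K' →* ℂ)
    (χ₁ : HeckeCharacter L) (χ₂ : ↥(TorusDict.torus (IsCMField.complexConj L)) →ₜ* ℂˣ) :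
    Submodule ℂ ((quasiSplit (↥(maximalRealSubfield L)) L (IsCMField.complexConj L) 3).L2 μ) :=
  resGBlock L μ K' ω χ₁ χ₂ ⊓ LinearMap.ker ((LinearMap.snd ℂ (A × M) Λ).comp U)

/-- **D2-top — THE TOP-POLE SLOT `At_top(U) := At(U) ⊓ ker (snd ∘ fst ∘ U)`**: atoms whose MIDDLE coordinate vanishes (case (i) of §13.9: residues at `z = 2`, the character lines `ℂ·[ψ∘det]`,
★ F6 `K2E1ChiEisensteinTopResidueCharLineU3`). [cite: Rogawski1990, §13.9 p. 229 (i)] [cite: MoeglinWaldspurger1995, VI.2] -/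
def resGAtomTop (U : (quasiSplit (↥(maximalRealSubfield L)) L (IsCMField.complexConj L) 3).L2 μ →ₗ[ℂ] (A × M) × Λ)
    (K' : Subgroup (quasiSplit (↥(maximalRealSubfield L)) L (IsCMField.complexConj L) 3).Adelic) (ω : ↥K' →* ℂ)
    (χ₁ : HeckeCharacter L) (χ₂ : ↥(TorusDict.torus (IsCMField.complexConj L)) →ₜ* ℂˣ) :
    Submodule ℂ ((quasiSplit (↥(maximalRealSubfield L)) L (IsCMField.complexConj L) 3).L2 μ) :=
  resGAtom L μ U K' ω χ₁ χ₂ ⊓ LinearMap.ker ((LinearMap.snd ℂ A M).comp ((LinearMap.fst ℂ (A × M) Λ).comp U))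

/-- **D2-mid — THE MIDDLE-POLE SLOT `At_mid(U) := At(U) ⊓ ker (fst ∘ fst ∘ U)`**: atoms whose TOP coordinate vanishes (case (ii) of §13.9: residues at `z = 3/2`, the `πⁿ(ξ)`-blocks;
their identification is the MID socket over the ξ-indexed middle block of record, a separate defs file). [cite: Rogawski1990, §13.9 p. 229 (ii)] [cite: MoeglinWaldspurger1995, V.3.13] -/
def resGAtomMid (U : (quasiSplit (↥(maximalRealSubfield L)) L (IsCMField.complexConj L) 3).L2 μ →ₗ[ℂ] (A × M) × Λ)
    (K' : Subgroup (quasiSplit (↥(maximalRealSubfield L)) L (IsCMField.complexConj L) 3).Adelic) (ω : ↥K' →* ℂ)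
    (χ₁ : HeckeCharacter L) (χ₂ : ↥(TorusDict.torus (IsCMField.complexConj L)) →ₜ* ℂˣ) :
    Submodule ℂ ((quasiSplit (↥(maximalRealSubfield L)) L (IsCMField.complexConj L) 3).L2 μ) :=
  resGAtom L μ U K' ω χ₁ χ₂ ⊓ LinearMap.ker ((LinearMap.fst ℂ A M).comp ((LinearMap.fst ℂ (A × M) Λ).comp U))

/-- **D3 — THE LINE PART `Ln(U; K′, ω; χ₁, χ₂) := Sc ⊓ At(U)ᗮ`** (regime R1: the orthocomplement of the atoms INSIDE the block; in the mathematics the closure of the unitary-axis wave packets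
`∫ h(t)·E(φ, 1 + it) dt` (E1 normalisation), an identification socket #2 does not use). [cite: MoeglinWaldspurger1995, VI.2] [cite: Langlands1976, §7] -/
def resGLine (U : (quasiSplit (↥(maximalRealSubfield L)) L (IsCMField.complexConj L) 3).L2 μ →ₗ[ℂ] (A × M) × Λ)
    (K' : Subgroup (quasiSplit (↥(maximalRealSubfield L)) L (IsCMField.complexConj L) 3).Adelic) (ω : ↥K' →* ℂ)
    (χ₁ : HeckeCharacter L) (χ₂ : ↥(TorusDict.torus (IsCMField.complexConj L)) →ₜ* ℂˣ) :
    Submodule ℂ ((quasiSplit (↥(maximalRealSubfield L)) L (IsCMField.complexConj L) 3).L2 μ) :=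
  resGBlock L μ K' ω χ₁ χ₂ ⊓ (resGAtom L μ U K' ω χ₁ χ₂)ᗮ

variable (U : (quasiSplit (↥(maximalRealSubfield L)) L (IsCMField.complexConj L) 3).L2 μ →ₗ[ℂ] (A × M) × Λ)
  (K' : Subgroup (quasiSplit (↥(maximalRealSubfield L)) L (IsCMField.complexConj L) 3).Adelic) (ω : ↥K' →* ℂ)
  (χ₁ : HeckeCharacter L) (χ₂ : ↥(TorusDict.torus (IsCMField.complexConj L)) →ₜ* ℂˣ)

/-- Read-back: `v ∈ At ↔ v ∈ Sc ∧ (U v).2 = 0`. [cite: MoeglinWaldspurger1995, VI.2] -/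
theorem mem_resGAtom_iff (v : (quasiSplit (↥(maximalRealSubfield L)) L (IsCMField.complexConj L) 3).L2 μ) :
    v ∈ resGAtom L μ U K' ω χ₁ χ₂ ↔ v ∈ resGBlock L μ K' ω χ₁ χ₂ ∧ (U v).2 = 0 :=
  Iff.rfl

/-- Read-back: `v ∈ At_top ↔ v ∈ At ∧ (U v).1.2 = 0`. [cite: MoeglinWaldspurger1995, VI.2] -/
theorem mem_resGAtomTop_iff (v : (quasiSplit (↥(maximalRealSubfield L)) L (IsCMField.complexConj L) 3).L2 μ) :
    v ∈ resGAtomTop L μ U K' ω χ₁ χ₂ ↔ v ∈ resGAtom L μ U K' ω χ₁ χ₂ ∧ (U v).1.2 = 0 :=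
  Iff.rfl

/-- Read-back: `v ∈ At_mid ↔ v ∈ At ∧ (U v).1.1 = 0`. [cite: MoeglinWaldspurger1995, VI.2] -/
theorem mem_resGAtomMid_iff (v : (quasiSplit (↥(maximalRealSubfield L)) L (IsCMField.complexConj L) 3).L2 μ) :
    v ∈ resGAtomMid L μ U K' ω χ₁ χ₂ ↔ v ∈ resGAtom L μ U K' ω χ₁ χ₂ ∧ (U v).1.1 = 0 :=
  Iff.rfl

/-- Read-back «at_le_sc»: `At ≤ Sc`. [cite: MoeglinWaldspurger1995, VI.2] -/
theorem resGAtom_le_resGBlock : resGAtom L μ U K' ω χ₁ χ₂ ≤ resGBlock L μ K' ω χ₁ χ₂ :=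
  inf_le_left

/-- Read-back: `At ≤ ker (snd ∘ U)` — atoms have zero line coordinate. [cite: MoeglinWaldspurger1995, VI.2] -/
theorem resGAtom_le_ker : resGAtom L μ U K' ω χ₁ χ₂ ≤ LinearMap.ker ((LinearMap.snd ℂ (A × M) Λ).comp U) :=
  inf_le_right

/-- Read-back: `At_top ≤ At`. [cite: MoeglinWaldspurger1995, VI.2] -/
theorem resGAtomTop_le_resGAtom : resGAtomTop L μ U K' ω χ₁ χ₂ ≤ resGAtom L μ U K' ω χ₁ χ₂ :=
  inf_le_left

/-- Read-back: `At_mid ≤ At`. [cite: MoeglinWaldspurger1995, VI.2] -/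
theorem resGAtomMid_le_resGAtom : resGAtomMid L μ U K' ω χ₁ χ₂ ≤ resGAtom L μ U K' ω χ₁ χ₂ :=
  inf_le_left

/-- Read-back: `At_top ≤ Sc`. [cite: MoeglinWaldspurger1995, VI.2] -/
theorem resGAtomTop_le_resGBlock : resGAtomTop L μ U K' ω χ₁ χ₂ ≤ resGBlock L μ K' ω χ₁ χ₂ :=
  (resGAtomTop_le_resGAtom L μ U K' ω χ₁ χ₂).trans (resGAtom_le_resGBlock L μ U K' ω χ₁ χ₂)

/-- Read-back: `At_mid ≤ Sc`. [cite: MoeglinWaldspurger1995, VI.2] -/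
theorem resGAtomMid_le_resGBlock : resGAtomMid L μ U K' ω χ₁ χ₂ ≤ resGBlock L μ K' ω χ₁ χ₂ :=
  (resGAtomMid_le_resGAtom L μ U K' ω χ₁ χ₂).trans (resGAtom_le_resGBlock L μ U K' ω χ₁ χ₂)

/-- Read-back: `At_top ⊔ At_mid ≤ At` (the two slots together are atoms; equality is a model letter about `U`, not claimed here). [cite: MoeglinWaldspurger1995, VI.2] -/
theorem resGAtomTop_sup_resGAtomMid_le_resGAtom : resGAtomTop L μ U K' ω χ₁ χ₂ ⊔ resGAtomMid L μ U K' ω χ₁ χ₂ ≤ resGAtom L μ U K' ω χ₁ χ₂ :=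
  sup_le (resGAtomTop_le_resGAtom L μ U K' ω χ₁ χ₂) (resGAtomMid_le_resGAtom L μ U K' ω χ₁ χ₂)

/-- Read-back: `v ∈ Ln ↔ v ∈ Sc ∧ v ∈ Atᗮ`. [cite: MoeglinWaldspurger1995, VI.2] -/
theorem mem_resGLine_iff (v : (quasiSplit (↥(maximalRealSubfield L)) L (IsCMField.complexConj L) 3).L2 μ) :
    v ∈ resGLine L μ U K' ω χ₁ χ₂ ↔ v ∈ resGBlock L μ K' ω χ₁ χ₂ ∧ v ∈ (resGAtom L μ U K' ω χ₁ χ₂)ᗮ :=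
  Iff.rfl

/-- Read-back «ln_le_sc»: `Ln ≤ Sc`. [cite: MoeglinWaldspurger1995, VI.2] -/
theorem resGLine_le_resGBlock : resGLine L μ U K' ω χ₁ χ₂ ≤ resGBlock L μ K' ω χ₁ χ₂ :=
  inf_le_left

/-- Read-back «ln_le_at_orthogonal»: `Ln ≤ Atᗮ`. [cite: MoeglinWaldspurger1995, VI.2] -/
theorem resGLine_le_orthogonal_resGAtom : resGLine L μ U K' ω χ₁ χ₂ ≤ (resGAtom L μ U K' ω χ₁ χ₂)ᗮ :=
  inf_le_right

/-- Read-back (in-block half of letter (O₃)): `At ⟂ Ln`. [cite: MoeglinWaldspurger1995, VI.2] -/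
theorem isOrtho_resGAtom_resGLine : resGAtom L μ U K' ω χ₁ χ₂ ⟂ resGLine L μ U K' ω χ₁ χ₂ :=
  (Submodule.isOrtho_orthogonal_right _).mono_right (resGLine_le_orthogonal_resGAtom L μ U K' ω χ₁ χ₂)

/-- Read-back: `At_top ⟂ Ln`. [cite: MoeglinWaldspurger1995, VI.2] -/
theorem isOrtho_resGAtomTop_resGLine : resGAtomTop L μ U K' ω χ₁ χ₂ ⟂ resGLine L μ U K' ω χ₁ χ₂ :=
  (isOrtho_resGAtom_resGLine L μ U K' ω χ₁ χ₂).mono_left (resGAtomTop_le_resGAtom L μ U K' ω χ₁ χ₂)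

/-- Read-back: `At_mid ⟂ Ln`. [cite: MoeglinWaldspurger1995, VI.2] -/
theorem isOrtho_resGAtomMid_resGLine : resGAtomMid L μ U K' ω χ₁ χ₂ ⟂ resGLine L μ U K' ω χ₁ χ₂ :=
  (isOrtho_resGAtom_resGLine L μ U K' ω χ₁ χ₂).mono_left (resGAtomMid_le_resGAtom L μ U K' ω χ₁ χ₂)

/-- **Read-back (N-iface) — «a vector whose block component has zero line coordinate is orthogonal to `Ln`»** (the (N_blk,₃) payer's interface, instance-free spelling, N = 3 twin of ★
`inner_eq_zero_of_mem_resHLine`): if `v ∈ Ln` and `x` splits as `x = y + (x − y)` with `y ∈ Sc`, `x − y ⟂ Sc` and `(U y).2 = 0` (the payer takes `y := P_{Sc} x`), then `⟪v, x⟫ = 0`: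
`y ∈ At`, `v ∈ Atᗮ ⊓ Sc`, so `⟪v, x⟫ = ⟪v, y⟫ + ⟪v, x − y⟫ = 0 + 0`. [cite: MoeglinWaldspurger1995, V.3.13, VI.2] -/
theorem inner_eq_zero_of_mem_resGLine {v : (quasiSplit (↥(maximalRealSubfield L)) L (IsCMField.complexConj L) 3).L2 μ} (hv : v ∈ resGLine L μ U K' ω χ₁ χ₂)
    (x : (quasiSplit (↥(maximalRealSubfield L)) L (IsCMField.complexConj L) 3).L2 μ)
    (hx : ∃ y ∈ resGBlock L μ K' ω χ₁ χ₂, x - y ∈ (resGBlock L μ K' ω χ₁ χ₂)ᗮ ∧ (U y).2 = 0) :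
    ⟪v, x⟫_ℂ = 0 := by
  obtain ⟨y, hy, hxy, hUy⟩ := hx
  have h1 : ⟪v, y⟫_ℂ = 0 := by
    rw [inner_eq_zero_symm]
    exact Submodule.inner_right_of_mem_orthogonal ((mem_resGAtom_iff L μ U K' ω χ₁ χ₂ y).2 ⟨hy, hUy⟩) hv.2
  have h2 : ⟪v, x - y⟫_ℂ = 0 := Submodule.inner_right_of_mem_orthogonal hv.1 hxy
  calc ⟪v, x⟫_ℂ = ⟪v, y + (x - y)⟫_ℂ := by rw [add_sub_cancel]
    _ = 0 := by rw [inner_add_right, h1, h2, add_zero]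

end Summit.HodgeConjecture.HodgeConjecture.R90.S8

end
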